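import Summits.KontsevichZagierPeriods.KontsevichZagierPeriods.Theorems.GpcZeta4Eq4zeta31.Negative.AlgebraicOnInterval

/-!
# `GpcZeta4Eq4zeta31` (stmt-KontsevichZagierPeriods-0275): negative side — derivatives of algebraic
# functions, and the transcendence of the primitives of `1/(1 − t)`

Companion of `AlgebraicOnInterval.lean` (cdisprove unit, cycle 2, 2026-08-16), the two analytic steps of the
Stokes-shadow obstruction (`StokesShadow.lean`):

* `AlgOn.exists_algOn_deriv` — **the derivative of an algebraic differentiable function is algebraic on a
  sub-interval** (descent on the `Y`-degree: for a vanishing polynomial `P` of minimal `Y`-degree,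
  `∂P/∂Y (s, F s)` is not identically zero, hence non-zero on a sub-interval, where `F' = −P_X(s,F)/P_Y(s,F)`);
* `not_algOn_of_hasDerivAt_one_div_one_sub` — **no function with derivative `1/(1 − t)` on an interval
  `(a, b)`, `b ≤ 1`, is algebraic there** (transcendence of `log (1 − t) + C` over `ℝ(t)`: the catalogued
  barrier's descent `NoSemialgPrimKernel.eq_zero_of_evalEval_eq_zero` of
  `Literature/Barriers/KontsevichZagierPeriods/AlgebraicPrimitivesObstruction.lean`, reached through the
  affine reparametrisation `t = a + (b − a)u`, `u ∈ (0,1)`, under which the derivative is `−1/(u − u₀)`).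

Sources: J. Ayoub, Ann. of Math. 181 (2015), Rem. 1.2; J. Fresán, *Une introduction aux périodes* (2024),
Rem. 3.6; [folklore].
-/

noncomputable section

namespace Summit.KontsevichZagierPeriods.GpcZeta4Eq4zeta31.Negative

open Set Polynomial
open scoped Polynomial.Bivariate
open Literature.Barriers.KontsevichZagierPeriods.KZ (NoSemialgPrim.coeff_sum_C_mul_X_pow
  NoSemialgPrimKernel.eq_zero_of_evalEval_eq_zero)
open Literature.ModelTheory.ExponentialFields (continuous_evalEval)
open Summit.KontsevichZagierPeriods.Theorems.StuffleInKZ.Negative.Growth (evalEval_eq_sum_range)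

/-! ## §5 The derivative of an algebraic function is algebraic on a sub-interval -/

/-- Differentiating `∑ⱼ pⱼ(s) F(s)ʲ ≡ 0`: `∑ⱼ (pⱼ' Fʲ + j pⱼ Fʲ⁻¹ F') = 0`. [folklore] -/
theorem sum_deriv_eq_zero_of_hasDerivAt {a b : ℝ} {F f : ℝ → ℝ}
    (hd : ∀ t ∈ Ioo a b, HasDerivAt F (f t) t) (N : ℕ) (p : ℕ → ℝ[X])
    (hv : ∀ s ∈ Ioo a b, ∑ j ∈ Finset.range N, (p j).eval s * F s ^ j = 0)
    {t : ℝ} (ht : t ∈ Ioo a b) :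
    ∑ j ∈ Finset.range N,
      ((derivative (p j)).eval t * F t ^ j + (p j).eval t * ((j : ℝ) * F t ^ (j - 1) * f t)) = 0 := by
  have hf : HasDerivAt (fun s => ∑ j ∈ Finset.range N, (p j).eval s * F s ^ j)
      (∑ j ∈ Finset.range N, ((derivative (p j)).eval t * F t ^ j +
        (p j).eval t * ((j : ℝ) * F t ^ (j - 1) * f t))) t :=
    HasDerivAt.fun_sum fun j _ => ((p j).hasDerivAt t).mul ((hd t ht).pow j)
  have h0 : HasDerivAt (fun s => ∑ j ∈ Finset.range N, (p j).eval s * F s ^ j) 0 t := by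
    apply (hasDerivAt_const t (0:ℝ)).congr_of_eventuallyEq
    filter_upwards [Ioo_mem_nhds ht.1 ht.2] with s hs
    exact hv s hs
  exact hf.unique h0

/-- **The derivative of an algebraic differentiable function is algebraic on a sub-interval.** If
`P(s, F s) = 0` on `(a, b)` with `P ≠ 0` of minimal `Y`-degree, then `∂P/∂Y (s, F s)` is not identically
zero (minimality), hence non-zero on a sub-interval by continuity, where `F' = −P_X(s,F)/P_Y(s,F)` is a
rational expression in the algebraic function `F`. [folklore] -/
theorem AlgOn.exists_algOn_deriv {a b : ℝ} (hab : a < b) {F f : ℝ → ℝ} (hF : AlgOn (Ioo a b) F)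
    (hd : ∀ s ∈ Ioo a b, HasDerivAt F (f s) s) :
    ∃ a' b' : ℝ, a' < b' ∧ Ioo a' b' ⊆ Ioo a b ∧ AlgOn (Ioo a' b') f := by
  classical
  -- a vanishing polynomial of minimal degree
  have hex : ∃ d : ℕ, ∃ P : ℝ[X][Y], P ≠ 0 ∧ P.natDegree = d ∧ ∀ s ∈ Ioo a b, P.evalEval s (F s) = 0 := by
    obtain ⟨P, hP, hv⟩ := hF
    exact ⟨P.natDegree, P, hP, rfl, hv⟩
  obtain ⟨P, hP0, hPd, hPv⟩ := Nat.find_spec hex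
  set d := Nat.find hex with hd_def
  have hmin : ∀ Q : ℝ[X][Y], Q ≠ 0 → Q.natDegree < d → ¬ ∀ s ∈ Ioo a b, Q.evalEval s (F s) = 0 := by
    intro Q hQ0 hQd hQv
    exact Nat.find_min hex hQd ⟨Q, hQ0, rfl, hQv⟩
  -- `d ≠ 0`: a non-zero polynomial in `x` alone cannot vanish on an interval
  have hd0 : d ≠ 0 := by
    intro hd0
    have hPC : P = C (P.coeff 0) := eq_C_of_natDegree_le_zero (by rw [hPd, hd0])
    have h0 : P.coeff 0 = 0 := by
      apply Polynomial.eq_zero_of_infinite_isRoot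
      refine Set.Infinite.mono ?_ (Set.Ioo_infinite hab)
      intro t ht
      have := hPv t ht
      rw [hPC, evalEval_C] at this
      exact this
    exact hP0 (by rw [hPC, h0, map_zero])
  -- coefficient family and the two derived polynomials
  set p : ℕ → ℝ[X] := fun j => P.coeff j with hp_def
  set PX : ℝ[X][Y] := ∑ j ∈ Finset.range (d + 1), C (derivative (p j)) * (X : ℝ[X][Y]) ^ j with hPX
  set PY : ℝ[X][Y] := ∑ j ∈ Finset.range d, C (C ((j : ℝ) + 1) * p (j + 1)) * (X : ℝ[X][Y]) ^ j
    with hPY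
  -- the relation as a coefficient sum
  have hv : ∀ s ∈ Ioo a b, ∑ j ∈ Finset.range (d + 1), (p j).eval s * F s ^ j = 0 := by
    intro s hs
    have := hPv s hs
    rwa [evalEval_eq_sum_range, hPd] at this
  -- `PY ≠ 0` and `deg PY < d`
  have hlead : p d ≠ 0 := by
    have : P.leadingCoeff ≠ 0 := leadingCoeff_ne_zero.mpr hP0
    rwa [leadingCoeff, hPd] at this
  have hPY0 : PY ≠ 0 := by
    intro h
    obtain ⟨d', hd'⟩ := Nat.exists_eq_succ_of_ne_zero hd0
    have hc := congrArg (fun Q : ℝ[X][Y] => Q.coeff d') h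
    simp only [hPY, coeff_zero] at hc
    rw [NoSemialgPrim.coeff_sum_C_mul_X_pow] at hc
    rw [if_pos (by omega)] at hc
    have hd1 : d' + 1 = d := by omega
    rw [hd1] at hc
    have : (C ((d' : ℝ) + 1) : ℝ[X]) ≠ 0 := by
      rw [Ne, C_eq_zero]; positivity
    exact (mul_ne_zero this hlead) hc
  have hPYdeg : PY.natDegree < d := by
    obtain ⟨d', hd'⟩ := Nat.exists_eq_succ_of_ne_zero hd0
    have hle : PY.natDegree ≤ d' := by
      refine natDegree_sum_le_of_forall_le _ _ fun j hj => ?_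
      refine (natDegree_C_mul_X_pow_le _ _).trans ?_
      have := Finset.mem_range.mp hj
      omega
    omega
  -- a point where `PY(s, F s) ≠ 0`, then an interval
  obtain ⟨s₀, hs₀, hne⟩ : ∃ s₀ ∈ Ioo a b, PY.evalEval s₀ (F s₀) ≠ 0 := by
    by_contra h
    push Not at h
    exact hmin PY hPY0 hPYdeg h
  have hFc : ContinuousAt F s₀ := (hd s₀ hs₀).continuousAt
  have hc : ContinuousAt (fun s => PY.evalEval s (F s)) s₀ :=
    (continuous_evalEval PY).continuousAt.comp (continuousAt_id.prodMk hFc)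
  have hev : ∀ᶠ s in nhds s₀, PY.evalEval s (F s) ≠ 0 := hc.eventually_ne hne
  have hev' : ∀ᶠ s in nhds s₀, s ∈ Ioo a b := Ioo_mem_nhds hs₀.1 hs₀.2
  obtain ⟨ε, hε, hball⟩ := Metric.eventually_nhds_iff.mp (hev.and hev')
  refine ⟨s₀ - ε, s₀ + ε, by linarith, fun s hs => ?_, ?_⟩
  · have : dist s s₀ < ε := by
      rw [Real.dist_eq, abs_lt]; constructor <;> linarith [hs.1, hs.2]
    exact (hball this).2
  -- on the interval: `f = -PX(s,F)/PY(s,F)`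
  have hsub : Ioo (s₀ - ε) (s₀ + ε) ⊆ Ioo a b := fun s hs => by
    have : dist s s₀ < ε := by
      rw [Real.dist_eq, abs_lt]; constructor <;> linarith [hs.1, hs.2]
    exact (hball this).2
  have hPYne : ∀ s ∈ Ioo (s₀ - ε) (s₀ + ε), PY.evalEval s (F s) ≠ 0 := fun s hs => by
    have : dist s s₀ < ε := by
      rw [Real.dist_eq, abs_lt]; constructor <;> linarith [hs.1, hs.2]
    exact (hball this).1
  have hformula : ∀ s ∈ Ioo (s₀ - ε) (s₀ + ε),
      f s = -(PX.evalEval s (F s)) / PY.evalEval s (F s) := by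
    intro s hs
    have hs' : s ∈ Ioo a b := hsub hs
    have hD := sum_deriv_eq_zero_of_hasDerivAt hd (d + 1) p hv hs'
    -- split the derivative identity into the `PX` part and the `PY` part
    have hsplit : ∑ j ∈ Finset.range (d + 1),
        ((derivative (p j)).eval s * F s ^ j + (p j).eval s * ((j : ℝ) * F s ^ (j - 1) * f s)) =
        PX.evalEval s (F s) + PY.evalEval s (F s) * f s := by
      rw [Finset.sum_add_distrib, hPX, hPY, evalEval_sum_C_mul_X_pow, evalEval_sum_C_mul_X_pow]
      congr 1
      rw [Finset.sum_mul, Finset.sum_range_succ']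
      simp only [Nat.cast_zero, zero_mul, mul_zero, add_zero]
      refine Finset.sum_congr rfl fun j _ => ?_
      simp only [Nat.cast_succ, Nat.add_sub_cancel, eval_mul, eval_C]
      ring
    rw [hsplit] at hD
    have hne' := hPYne s hs
    field_simp
    linarith
  have hFalg : AlgOn (Ioo (s₀ - ε) (s₀ + ε)) F := hF.mono hsub
  have h1 : AlgOn (Ioo (s₀ - ε) (s₀ + ε)) fun s => PX.evalEval s (F s) := hFalg.evalEval PX
  have h2 : AlgOn (Ioo (s₀ - ε) (s₀ + ε)) fun s => PY.evalEval s (F s) := hFalg.evalEval PY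
  exact ((h1.neg).div h2 hPYne).congr fun s hs => by simp only [Pi.neg_apply]; exact (hformula s hs).symm

/-! ## §6 No function with derivative `1/(1 − t)` is algebraic on an interval below `1` -/

/-- Transport of a bivariate polynomial along an affine reparametrisation of the first variable:
`(P.map (comp ℓ))(u, y) = P(ℓ(u), y)`. [folklore] -/
theorem evalEval_map_compRingHom (P : ℝ[X][Y]) (ℓ : ℝ[X]) (u y : ℝ) :
    (P.map (compRingHom ℓ)).evalEval u y = P.evalEval (ℓ.eval u) y := by
  have key : (evalEvalRingHom u y).comp (mapRingHom (compRingHom ℓ)) = evalEvalRingHom (ℓ.eval u) y := by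
    refine Polynomial.ringHom_ext (fun p => ?_) ?_
    · change ((C p : ℝ[X][Y]).map (compRingHom ℓ)).evalEval u y = (C p : ℝ[X][Y]).evalEval (ℓ.eval u) y
      rw [map_C, evalEval_C, evalEval_C, coe_compRingHom_apply, eval_comp]
    · change ((X : ℝ[X][Y]).map (compRingHom ℓ)).evalEval u y = (X : ℝ[X][Y]).evalEval (ℓ.eval u) y
      rw [map_X, evalEval_X, evalEval_X]
  exact congrArg (fun φ : ℝ[X][Y] →+* ℝ => φ P) key

/-- Composition with a non-constant affine polynomial is injective on `ℝ[X]`. [folklore] -/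
theorem compRingHom_injective {a c : ℝ} (hc : c ≠ 0) :
    Function.Injective (compRingHom (C a + C c * X : ℝ[X])) := by
  set ℓ : ℝ[X] := C a + C c * X
  have hℓ1 : ℓ.natDegree = 1 := by
    rw [show ℓ = C c * X + C a by ring]
    exact natDegree_linear hc
  rw [injective_iff_map_eq_zero]
  intro p hp
  rw [coe_compRingHom_apply] at hp
  rcases (comp_eq_zero_iff.mp hp) with h | ⟨-, h⟩
  · exact h
  · have := congrArg natDegree h
    rw [hℓ1, natDegree_C] at this
    exact absurd this one_ne_zero

/-- **No function with derivative `1/(1 − t)` on an interval `(a, b)`, `b ≤ 1`, is algebraic there**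
(transcendence of `log (1 − t) + C` over `ℝ(t)`; the catalogued barrier's descent
`NoSemialgPrimKernel.eq_zero_of_evalEval_eq_zero`, reached by the affine reparametrisation
`t = a + (b − a)u`, `u ∈ (0, 1)`, under which the derivative becomes `−1/(u − u₀)`, `u₀ = (1−a)/(b−a) ≥ 1`).
[folklore] -/
theorem not_algOn_of_hasDerivAt_one_div_one_sub {a b : ℝ} (hab : a < b) (hb : b ≤ 1) {L : ℝ → ℝ}
    (hL : ∀ t ∈ Ioo a b, HasDerivAt L (1 / (1 - t)) t) : ¬ AlgOn (Ioo a b) L := by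
  rintro ⟨P, hP0, hPv⟩
  set c : ℝ := b - a with hc
  have hc0 : c ≠ 0 := by rw [hc]; linarith
  have hcpos : 0 < c := by rw [hc]; linarith
  set ℓ : ℝ[X] := C a + C c * X with hℓ
  have hℓev : ∀ u : ℝ, ℓ.eval u = a + c * u := fun u => by simp [hℓ]
  -- the transported function `u ↦ L (a + c u)` on `(0,1)` and its derivative `-1/(u - u₀)`
  obtain ⟨u₀, hu₀⟩ : ∃ u₀ : ℝ, u₀ = (1 - a) / c := ⟨_, rfl⟩
  have hmemI : ∀ u ∈ Ioo (0:ℝ) 1, a + c * u ∈ Ioo a b := fun u hu => by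
    constructor <;> nlinarith [hu.1, hu.2]
  have hsub1 : ∀ u ∈ Ioo (0:ℝ) 1, 1 - (a + c * u) ≠ 0 := fun u hu => by
    have := (hmemI u hu).2; linarith
  have hne' : ∀ u ∈ Ioo (0:ℝ) 1, u - u₀ ≠ 0 := fun u hu => by
    rw [hu₀]
    have : u - (1 - a) / c = -(1 - (a + c * u)) / c := by field_simp; ring
    rw [this]
    exact div_ne_zero (neg_ne_zero.mpr (hsub1 u hu)) hc0
  have hG' : ∀ u ∈ Ioo (0:ℝ) 1, HasDerivAt (fun u => L (a + c * u)) (-1 / (u - u₀)) u := by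
    intro u hu
    have h1 : HasDerivAt (fun u : ℝ => a + c * u) c u := by
      simpa using ((hasDerivAt_id u).const_mul c).const_add a
    have h2 : HasDerivAt (fun u => L (a + c * u)) (1 / (1 - (a + c * u)) * c) u :=
      (hL _ (hmemI u hu)).comp u h1
    have hA := hsub1 u hu
    have e : u - u₀ = -(1 - (a + c * u)) / c := by rw [hu₀]; field_simp; ring
    have e2 : (1 / (1 - (a + c * u)) * c : ℝ) = -1 / (u - u₀) := by
      rw [e, eq_div_iff (div_ne_zero (neg_ne_zero.mpr hA) hc0)]
      field_simp
    exact h2.congr_deriv e2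
  -- the barrier's step (C)–(D) with `x₀ = u₀`, `V = −1`, `N = 1`
  have hDN : ∀ u ∈ Ioo (0:ℝ) 1,
      ((X - C u₀) * C (-1 : ℝ)).eval u * (-1 / (u - u₀)) = (1 : ℝ[X]).eval u := by
    intro u hu
    have hB := hne' u hu
    simp only [eval_mul, eval_sub, eval_X, eval_C, eval_one]
    field_simp
  have hV : (C (-1 : ℝ)).eval u₀ ≠ 0 := by simp
  have hN : (1 : ℝ[X]).eval u₀ ≠ 0 := by simp
  -- the transported polynomial
  set Q : ℝ[X][Y] := P.map (compRingHom ℓ) with hQ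
  have hQ0 : Q ≠ 0 := fun h =>
    hP0 (Polynomial.map_injective _ (compRingHom_injective (a := a) hc0) (by rw [← hQ]; rw [h, Polynomial.map_zero]))
  have hQv : ∀ u ∈ Ioo (0:ℝ) 1, Q.evalEval u (L (a + c * u)) = 0 := by
    intro u hu
    rw [hQ, evalEval_map_compRingHom, hℓev]
    exact hPv _ (hmemI u hu)
  exact hQ0 (NoSemialgPrimKernel.eq_zero_of_evalEval_eq_zero hG' hDN hV hN Q.natDegree Q le_rfl hQv)

end Summit.KontsevichZagierPeriods.GpcZeta4Eq4zeta31.Negative
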